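import Literature.Computability.AlgebraicComplexity.BurgisserThm210Proofs
import Literature.Computability.AlgebraicComplexity.AffineSignDetBounds
import Literature.Computability.AlgebraicComplexity.SharpPBitsPPoly
import HarnessLib

set_option linter.dupNamespace false

/-!
# Stub `stub_transferCore` — the explicit algebraic core of Bürgisser 2009, Thm. 4.1(2),
# under a sign-determinantal expression of the permanent

Crux `TauBurgisserDet` (item `stmt-ValiantsHypothesis-7680`), line `registered`.

For a fan-in-two sign-constant circuit `P` over `σ ⊕ Fin u` of size `≤ S` and formal degree
`≤ D`, a substitution `g : σ → ℤ[τ]`, an explicit cost bound `τ(DET_m) ≤ m^cd + cd` for the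
constant-free complexity of the generic determinant, and sign-determinantal expressions
`det A = N · PER_pd^d` (`A` an `m × m` matrix of affine forms in the `pd²` variables with all
coefficients in `{−1, 0, 1}`, `m ≤ 2^((log₂ pd + cA)^cA)`, `N ≠ 0`, `d ≥ 1`) for all `pd ≥ n₀`,
we produce `N ≠ 0`, `e`, `d ≥ 1` with an explicit bound on
`τ(N · (2^e · (∑_e P(X, e))(g))^d)`.

Proof (Bürgisser, ECCC TR06-113, proof of Thm. 4.1(2), with Thm. 2.10 = Koiran 2004 Thm. 4.3
inside, at explicit size):
* [a] `ArithCircuit.exists_permanent_boolSum`: `per B = 2^K · ∑_e P(X, e)` with good entries,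
  `N + K ≤ cfBound`;
* [b] `ArithCircuit.exists_perProjection_matrix` at dimension
  `Pd := max n₀ (cfBound S D u + S + 2)`: `per B' = 2^Pd · ∑_e P(X, e)` with admissible entries;
* [c] the hypothesis at `pd := Pd ≥ n₀` and the substitution of the entries of `B'` for the
  variables `X_{ij}`: `det (A(B')) = N · (2^Pd · ∑_e P(X, e))^d` (`AlgHom.map_det`,
  `aeval_entries_perPoly`);
* [d] the cost: `τ(det A(B')) ≤ τ(DET_m) + ∑_{ij} τ(A_{ij}(B'))` (`constantFreeComplexity_det_le`),
  `τ(A_{ij}(B')) ≤ (2 Pd² + 1) + Pd² (Pd + 2)` (`constantFreeComplexity_le_of_affine_unit`,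
  `IsPerProjectionEntry.constantFreeComplexity_le`, `constantFreeComplexity_aeval_le`), and
  finally `τ(f(g)) ≤ τ(f) + ∑_v τ(g v)`.

## References

* [Burgisser2009] P. Bürgisser, *On defining integers and proving arithmetic circuit lower
  bounds*, Comput. Complexity 18 (2009) 81–103 (ECCC TR06-113), Thm. 2.10, Thm. 4.1(2).
* [Koiran2004] P. Koiran, *Valiant's model and the cost of computing integers*, Comput.
  Complexity 13 (2004) 131–146, Thm. 4.3.
* [Burgisser2000] P. Bürgisser, *Completeness and Reduction in Algebraic Complexity Theory*,
  Springer 2000, Rem. 2.7 (substitution).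
-/

noncomputable section

open MvPolynomial

namespace Summit.ValiantsHypothesis.ValiantsHypothesis.Theorems.IntegralOrbitsTauBurgisserDet

open Literature.Computability.AlgebraicComplexity

/-- **Step [c]: substitution carries the sign-determinantal expression to the Boolean sum.**
If `per B' = 2^p · q` and `det A = N · PER_p^d`, then substituting the entries of `B'` for the
variables `X_{ij}` of `A` gives `det (A(B')) = N · (2^p · q)^d`. [cite: Burgisser2009, proof of Thm. 4.1(2)] -/
theorem tcore_det_map_aeval_entries_eq {σ : Type} {p m d : ℕ} {N : ℤ}
    (B' : Matrix (Fin p) (Fin p) (MvPolynomial σ ℤ)) (q : MvPolynomial σ ℤ)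
    (hper : B'.permanent = C ((2 : ℤ) ^ p) * q)
    (A : Matrix (Fin m) (Fin m) (MvPolynomial (Fin p × Fin p) ℤ))
    (hA : A.det = C N * perPoly (Fin p) ℤ ^ d) :
    (A.map (aeval fun ij : Fin p × Fin p => B' ij.1 ij.2)).det = C N * (C ((2 : ℤ) ^ p) * q) ^ d := by
  rw [← AlgHom.mapMatrix_apply, ← AlgHom.map_det, hA, map_mul, map_pow, aeval_entries_perPoly, hper,
    MvPolynomial.aeval_C, MvPolynomial.algebraMap_eq]

/-- **Step [d], one entry: the cost of an affine unit form at admissible entries.** For an affine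
form `a` in the `p²` variables with coefficients in `{−1, 0, 1}` and a `p × p` matrix `B'` of
admissible entries (`IsPerProjectionEntry p`), `τ(a(B')) ≤ p³ + 4 p² + 1`. [cite: Burgisser2000, Rem. 2.7] -/
theorem tcore_constantFreeComplexity_aeval_entries_affine_le {σ : Type} {p : ℕ}
    (B' : Matrix (Fin p) (Fin p) (MvPolynomial σ ℤ)) (hB' : ∀ i j, IsPerProjectionEntry p (B' i j))
    {a : MvPolynomial (Fin p × Fin p) ℤ} (hdeg : a.totalDegree ≤ 1) (hco : ∀ s, |coeff s a| ≤ 1) :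
    constantFreeComplexity (aeval (fun ij : Fin p × Fin p => B' ij.1 ij.2) a) ≤ p ^ 3 + 4 * p ^ 2 + 1 := by
  calc constantFreeComplexity (aeval (fun ij : Fin p × Fin p => B' ij.1 ij.2) a)
      ≤ constantFreeComplexity a + ∑ ij : Fin p × Fin p, constantFreeComplexity (B' ij.1 ij.2) :=
        constantFreeComplexity_aeval_le _ _
    _ ≤ (2 * Fintype.card (Fin p × Fin p) + 1) + ∑ _ij : Fin p × Fin p, (p + 2) :=
        add_le_add (constantFreeComplexity_le_of_affine_unit hdeg hco)
          (Finset.sum_le_sum fun ij _ => (hB' ij.1 ij.2).constantFreeComplexity_le)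
    _ = p ^ 3 + 4 * p ^ 2 + 1 := by
        simp only [Fintype.card_prod, Fintype.card_fin, Finset.sum_const, Finset.card_univ,
          smul_eq_mul]
        ring

/-- **Step [d]: the cost of the substituted determinant.** For an `m × m` matrix `A` of affine
unit forms in the `p²` variables and a `p × p` matrix `B'` of admissible entries,
`τ(det A(B')) ≤ τ(DET_m) + m² (p³ + 4 p² + 1)`. [cite: Burgisser2000, Rem. 2.7] -/
theorem tcore_constantFreeComplexity_det_map_le {σ : Type} {p m : ℕ}
    (B' : Matrix (Fin p) (Fin p) (MvPolynomial σ ℤ)) (hB' : ∀ i j, IsPerProjectionEntry p (B' i j))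
    (A : Matrix (Fin m) (Fin m) (MvPolynomial (Fin p × Fin p) ℤ))
    (hdeg : ∀ i j, (A i j).totalDegree ≤ 1) (hco : ∀ i j s, |coeff s (A i j)| ≤ 1) :
    constantFreeComplexity (A.map (aeval fun ij : Fin p × Fin p => B' ij.1 ij.2)).det ≤
      constantFreeComplexity (detPoly (Fin m) ℤ) + m ^ 2 * (p ^ 3 + 4 * p ^ 2 + 1) := by
  refine (constantFreeComplexity_det_le _).trans (Nat.add_le_add_left ?_ _)
  calc ∑ ij : Fin m × Fin m,
        constantFreeComplexity ((A.map (aeval fun ij : Fin p × Fin p => B' ij.1 ij.2)) ij.1 ij.2)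
      ≤ ∑ _ij : Fin m × Fin m, (p ^ 3 + 4 * p ^ 2 + 1) := Finset.sum_le_sum fun ij _ => by
        rw [Matrix.map_apply]
        exact tcore_constantFreeComplexity_aeval_entries_affine_le B' hB' (hdeg ij.1 ij.2) (hco ij.1 ij.2)
    _ = m ^ 2 * (p ^ 3 + 4 * p ^ 2 + 1) := by
        simp only [Fintype.card_prod, Fintype.card_fin, Finset.sum_const, Finset.card_univ,
          smul_eq_mul]
        ring

/-- **Stub `stub_transferCore`** — the explicit algebraic core of Bürgisser 2009, Thm. 4.1(2),
with a sign-determinantal expression `det A = N · PER^d` in place of "`τ(PER)` p-bounded":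
for a fan-in-two sign-constant circuit `P` over `σ ⊕ Fin u` (size `≤ S`, formal degree `≤ D`)
and a substitution `g`, with `Pd := max n₀ (cfBound S D u + S + 2)` and
`mb := 2^((log₂ Pd + cA)^cA)`: there are `N ≠ 0`, `e`, `d ≥ 1` with
`τ(N · (2^e · (∑_e P)(g))^d) ≤ mb^cd + cd + mb² (Pd³ + 4 Pd² + 1) + ∑_v τ(g v)`.
Steps: the Boolean sum is `2^{-Pd} per B'` (Thm. 2.10 at explicit size,
`exists_permanent_boolSum`, `exists_perProjection_matrix`), the sign-determinantal expression at
dimension `Pd ≥ n₀` under the substitution of the entries of `B'`, and the constant-free cost of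
the substituted determinant. [cite: Burgisser2009, Thm. 4.1(2)] [cite: Koiran2004, Thm. 4.3] -/
theorem stub_transferCore :
    ∀ (σ τ : Type) [Fintype σ] (u S D cd n₀ cA : ℕ)
      (P : Literature.Computability.AlgebraicComplexity.ArithCircuit ℤ (σ ⊕ Fin u)) (g : σ → MvPolynomial τ ℤ),
      P.IsFanInTwo → P.HasSignConstants → P.size ≤ S → P.formalDegree ≤ D →
      (∀ m, Literature.Computability.AlgebraicComplexity.constantFreeComplexity (Literature.Computability.AlgebraicComplexity.detPoly (Fin m) ℤ) ≤ m ^ cd + cd) →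
      (∀ pd ≥ n₀, ∃ (m d : ℕ) (N : ℤ) (A : Matrix (Fin m) (Fin m) (MvPolynomial (Fin pd × Fin pd) ℤ)),
          1 ≤ d ∧ m ≤ 2 ^ ((Nat.log 2 pd + cA) ^ cA) ∧ N ≠ 0 ∧ (∀ i j, (A i j).totalDegree ≤ 1) ∧
            (∀ i j s, |MvPolynomial.coeff s (A i j)| ≤ 1) ∧
            A.det = MvPolynomial.C N * Literature.Computability.AlgebraicComplexity.perPoly (Fin pd) ℤ ^ d) →
      ∃ (N : ℤ) (e d : ℕ), N ≠ 0 ∧ 1 ≤ d ∧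
        Literature.Computability.AlgebraicComplexity.constantFreeComplexity
            (MvPolynomial.C N * (MvPolynomial.C ((2 : ℤ) ^ e) * MvPolynomial.aeval g (Literature.Computability.AlgebraicComplexity.boolSum P.eval)) ^ d) ≤
          (2 ^ ((Nat.log 2 (max n₀ (Literature.Computability.AlgebraicComplexity.ArithCircuit.cfBound S D u + S + 2)) + cA) ^ cA)) ^ cd + cd +
            (2 ^ ((Nat.log 2 (max n₀ (Literature.Computability.AlgebraicComplexity.ArithCircuit.cfBound S D u + S + 2)) + cA) ^ cA)) ^ 2 *
              ((max n₀ (Literature.Computability.AlgebraicComplexity.ArithCircuit.cfBound S D u + S + 2)) ^ 3 +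
                4 * (max n₀ (Literature.Computability.AlgebraicComplexity.ArithCircuit.cfBound S D u + S + 2)) ^ 2 + 1) +
            ∑ v, Literature.Computability.AlgebraicComplexity.constantFreeComplexity (g v) := by
  intro σ τ _ u S D cd n₀ cA P g h2 hsc hS hD hdet hsd
  -- the dimension `Pd`
  obtain ⟨Pd, hn₀, hcf, hPd⟩ : ∃ Pd, n₀ ≤ Pd ∧ ArithCircuit.cfBound S D u + S + 2 ≤ Pd ∧
      max n₀ (ArithCircuit.cfBound S D u + S + 2) = Pd :=
    ⟨_, le_max_left _ _, le_max_right _ _, rfl⟩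
  rw [hPd]
  -- [a] the permanent form of the Boolean sum
  obtain ⟨N, K, B, hNK, hB, hper⟩ := ArithCircuit.exists_permanent_boolSum P h2 hsc
  have hPg : P.gates.length ≤ S := hS
  have hNK' : N + K ≤ ArithCircuit.cfBound S D u :=
    hNK.trans (cfBound_mono hPg hD le_rfl)
  -- [b] scaling and padding to dimension `Pd`
  obtain ⟨B', hB'e, hB'per⟩ := ArithCircuit.exists_perProjection_matrix (boolSum P.eval) B hB hper Pd
    (by omega) (by omega)
  -- [c] the sign-determinantal expression at `pd := Pd`, under the substitution of the entries of `B'`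
  obtain ⟨mA, dA, NA, A, hdA, hmA, hNA, hdeg, hco, hA⟩ := hsd Pd hn₀
  refine ⟨NA, Pd, dA, hNA, hdA, ?_⟩
  have key : C NA * (C ((2 : ℤ) ^ Pd) * aeval g (boolSum P.eval)) ^ dA =
      aeval g (A.map (aeval fun ij : Fin Pd × Fin Pd => B' ij.1 ij.2)).det := by
    rw [tcore_det_map_aeval_entries_eq B' (boolSum P.eval) hB'per A hA]
    simp only [map_mul, map_pow, MvPolynomial.aeval_C, MvPolynomial.algebraMap_eq]
  -- [d] the cost
  rw [key]
  refine (constantFreeComplexity_aeval_le _ _).trans (Nat.add_le_add_right ?_ _)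
  refine (tcore_constantFreeComplexity_det_map_le B' hB'e A hdeg hco).trans ?_
  have h1 : constantFreeComplexity (detPoly (Fin mA) ℤ) ≤ (2 ^ ((Nat.log 2 Pd + cA) ^ cA)) ^ cd + cd :=
    (hdet mA).trans (Nat.add_le_add_right (Nat.pow_le_pow_left hmA cd) cd)
  have h2 : mA ^ 2 * (Pd ^ 3 + 4 * Pd ^ 2 + 1) ≤
      (2 ^ ((Nat.log 2 Pd + cA) ^ cA)) ^ 2 * (Pd ^ 3 + 4 * Pd ^ 2 + 1) :=
    Nat.mul_le_mul_right _ (Nat.pow_le_pow_left hmA 2)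
  exact Nat.add_le_add h1 h2

end Summit.ValiantsHypothesis.ValiantsHypothesis.Theorems.IntegralOrbitsTauBurgisserDet
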